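import Summits.Ventures.CertifiedManyBodySolver.Theorems.M3x2EdgeSplitSymReplayGramRShardsGrouped
import HarnessLib

/-!
# SymReplay checker — the BOX-CANON licence (`canonTermAB`): frame membership by four integer comparisons

(defs `inBox / anchoredNFsB / canonAB / canonTermAB / maxCornerP` = hub-lb-sym-ref-1's measured text, pub
`hub-lb-sym-ref-1/g1-baseshard/ProbeE3.lean` «BOX variant», verbatim; licence, bridge and executed paths by hub-lb-sym-eng-3.
ADDITIVE on `…SyntaxV` (`canonTermAV`), `…LocalB` (`canonNFZV`, local shards), `…GramRShardsFast/Local/Grouped` (R paths);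
nothing of them is touched.)

WHY.  `canonTermAV cP frame` tests each of the ≤ 8 moved copies of a word with `suppIn w frame` — a scan of the whole frame
list per letter (625 sites on a rung-V object); when the frame IS an integer box `[lo.1, hi.1] × [lo.2, hi.2]` the same test
is four comparisons per letter.  Measured by hub-lb-sym-ref-1 on real words of block `mm.c0/22` (STATUS 2026-08-28 l.1298):
canon 3.01 → 1.33 ms/term (×2.26), all-in 2.99 → 1.90 ms per expansion product (×1.57); crit-1 V105 (ii): v0′ Gram shards
`J = 2` instead of `3` when this is in the tree.

CONTENTS.  (a) the box primitives; (b) the LICENCE `boxLicence frame lo hi : Bool` — `minCornerP frame = lo`, every frame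
site in the box, every box site in the frame (checked ONCE per certificate, `decide`/`native_decide`, ≈ |frame|² Bool ops);
(c) the bridge `inBox_eq_suppIn` ⇒ `psuppInB_eq`, `anchoredNFsB_eq`, `canonAB_eq`, `canonTermAB_eq : canonTermAB lo hi =
canonTermAV (minCornerP frame) frame`, `canonNFZB_eq : canonNFZB lo hi p = canonNFZV frame p`; (d) executed per-call facts with
`_eq`/transfer lemmas and closing theorems on the three paths of record — grouped R shards (`shardOKRGB`, `ShardFactsRGB`,
`gramROKAtB`, `GramROKFactsB`, `energyDensity_ge_of_shardsRGB`), local dense shards (`shardOKLB`, `ShardFactsLB`,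
`energyDensity_ge_of_shardsLB`), one call (`symCheckLB`, `energyDensity_ge_symValueLB`); (e) kernel demos on the toys.
Soundness is untouched: every B object equals its landed V/LV/RGV twin under the licence.

GROUPED CLOSING GRAMMAR WITH THE BOX LICENCE (R-literal `K := decodeSymCertR (toks certS) (toks gramRS)`, literals `lo hi : ℤ × ℤ`
= the frame's corners): `hbox : boxLicence K.frame lo hi = true := by native_decide` (once), per shard
`shard_j : shardOKRGB K c sizes lo hi j P_j = true := by native_decide`, per R-block `rok_i : gramROKAtB K lo hi i = true`,
`hRok := gramR_all_of_factsB K lo hi hbox n hn ⟨rok_0, …, trivial⟩`, `hcount : shardCountRG K c sizes = m + 1`,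
`hfacts : ShardFactsRGB K c sizes lo hi 0 [P₀, …] := ⟨shard_0, …, trivial⟩`, `hfin : isZero (canonNFZB lo hi [P₀, …].flatten) = true`,
close `energyDensity_ge_of_shardsRGB K hwf hRok c sizes lo hi hbox [P₀, …] hcount hfacts hfin`.

HONEST FRAMING: a checker COST lever; no certificate lands by this file; no bound of record moves; no summit or crux statement is
proved here; nothing here predicts superconductivity.
-/

noncomputable section

namespace Summit.Ventures.CertifiedManyBodySolver.Theorems.SymReplay

open Matrix Finset
open Literature.MathematicalPhysics.QuantumLattice
open Literature.MathematicalPhysics.QuantumLattice.HubbardWave0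
open Literature.MathematicalPhysics.QuantumLattice.ThermodynamicLimit
open Literature.Probability.LatticeModels
open Literature.MathematicalPhysics.QuantumManyBody.StateRelaxation
open Summit.Ventures.CertifiedManyBodySolver.Theorems.WardSlot
open scoped ComplexOrder BigOperators

/-! ##### (a) Box primitives (hub-lb-sym-ref-1's text) -/

/-- Componentwise maximum corner of a site list (junk `(0,0)` on `[]`); with `minCornerP` the two literals of the licence. -/
def maxCornerP : List (Site 2) → ℤ × ℤ
  | [] => (0, 0)
  | [x] => (x 0, x 1)
  | x :: l => let m := maxCornerP l; (max (x 0) m.1, max (x 1) m.2)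

/-- A site lies in the integer box `[lo.1, hi.1] × [lo.2, hi.2]` — four comparisons. -/
def inBoxSite (lo hi : ℤ × ℤ) (x : Site 2) : Bool :=
  let a := x 0; let b := x 1
  decide (lo.1 ≤ a) && decide (a ≤ hi.1) && decide (lo.2 ≤ b) && decide (b ≤ hi.2)

/-- Every letter of `w` lies in the box (replaces `suppIn w frame`, a scan of the frame list per letter). -/
def inBox (lo hi : ℤ × ℤ) (w : Word) : Bool :=
  w.all fun ℓ => let a := ℓ.x 0; let b := ℓ.x 1;
    decide (lo.1 ≤ a) && decide (a ≤ hi.1) && decide (lo.2 ≤ b) && decide (b ≤ hi.2)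

/-- Every word of `p` lies in the box (replaces `psuppIn p frame`). -/
def psuppInB (lo hi : ℤ × ℤ) (p : QPoly) : Bool := p.all fun t => inBox lo hi t.2

/-- `anchoredNFsV` with the box test: the ≤ 8 anchored affine-`D₄` copies of `u` that fit the box, normal-ordered. -/
def anchoredNFsB (lo hi : ℤ × ℤ) (u : Word) : List QPoly :=
  d4All.filterMap fun γ =>
    let m := minCornerP (wordSites (moveWordV γ 0 u))
    let a := lo.1 - m.1
    let b := lo.2 - m.2
    let w := moveWordV γ (mkSite a b) u
    if inBox lo hi w then some (nfWord w) else none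

/-- `canonAV` with the box test. -/
def canonAB (lo hi : ℤ × ℤ) (u : Word) : QPoly :=
  match anchoredNFsB lo hi u with
  | [] => [(1, u)]
  | c :: cs =>
    let best := cs.foldl (fun b c' => if polyKeyLt c' b then c' else b) c
    if (c :: cs).any (polyNegEq best) then [] else best

/-- `canonTermAV` with the box test (**the box canonicaliser**). -/
def canonTermAB (lo hi : ℤ × ℤ) (t : ℚ × Word) : QPoly := pscale t.1 (canonAB lo hi t.2)

/-- The sites of the box, enumerated (used only by the licence check). -/
def boxSites (lo hi : ℤ × ℤ) : List (Site 2) :=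
  (List.range (hi.1 - lo.1 + 1).toNat).flatMap fun (i : ℕ) =>
    (List.range (hi.2 - lo.2 + 1).toNat).map fun (j : ℕ) => mkSite (lo.1 + (i : ℤ)) (lo.2 + (j : ℤ))

/-! ##### (b) The licence -/

/-- **Box licence**: the frame IS the integer box `[lo, hi]` as a set of sites, and `lo` is its min corner — checked once
per certificate (`native_decide`/`decide`; ≈ |frame|·|box| site comparisons). -/
def boxLicence (frame : List (Site 2)) (lo hi : ℤ × ℤ) : Bool :=
  decide (minCornerP frame = lo) && frame.all (inBoxSite lo hi) && (boxSites lo hi).all fun x => memSite x frame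

/-! ##### (c) The bridge: under the licence every box object IS its landed twin -/

/-- A site with coordinates in the box is one of the enumerated box sites. -/
theorem mkSite_mem_boxSites {lo hi : ℤ × ℤ} {a b : ℤ} (h1 : lo.1 ≤ a) (h2 : a ≤ hi.1) (h3 : lo.2 ≤ b) (h4 : b ≤ hi.2) :
    mkSite a b ∈ boxSites lo hi := by
  have hi1 : (a - lo.1).toNat < (hi.1 - lo.1 + 1).toNat := by omega
  have hi2 : (b - lo.2).toNat < (hi.2 - lo.2 + 1).toNat := by omega
  have heq : mkSite (lo.1 + ((a - lo.1).toNat : ℤ)) (lo.2 + ((b - lo.2).toNat : ℤ)) = mkSite a b := by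
    rw [Int.toNat_of_nonneg (by omega), Int.toNat_of_nonneg (by omega)]
    congr 1 <;> ring
  exact List.mem_flatMap.2 ⟨_, List.mem_range.2 hi1, List.mem_map.2 ⟨_, List.mem_range.2 hi2, heq⟩⟩

/-- A site is `mkSite` of its two coordinates. -/
theorem mkSite_coords (x : Site 2) : mkSite (x 0) (x 1) = x := by
  ext i
  fin_cases i <;> rfl

/-- Under the licence, box membership of a site IS frame membership. -/
theorem inBoxSite_eq_memSite {frame : List (Site 2)} {lo hi : ℤ × ℤ} (h : boxLicence frame lo hi = true) (x : Site 2) :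
    inBoxSite lo hi x = memSite x frame := by
  simp only [boxLicence, Bool.and_eq_true, List.all_eq_true] at h
  obtain ⟨⟨-, hF⟩, hB⟩ := h
  rw [Bool.eq_iff_iff, memSite_iff]
  constructor
  · intro hx
    have hx' := hx
    simp only [inBoxSite, Bool.and_eq_true, decide_eq_true_eq] at hx'
    obtain ⟨⟨⟨h1, h2⟩, h3⟩, h4⟩ := hx'
    have hm := hB _ (mkSite_mem_boxSites h1 h2 h3 h4)
    rw [mkSite_coords] at hm
    exact (memSite_iff x frame).1 hm
  · intro hx
    exact hF x hx

/-- Under the licence, `inBox lo hi w = suppIn w frame`. -/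
theorem inBox_eq_suppIn {frame : List (Site 2)} {lo hi : ℤ × ℤ} (h : boxLicence frame lo hi = true) (w : Word) :
    inBox lo hi w = suppIn w frame := by
  have hw : inBox lo hi w = w.all fun ℓ => inBoxSite lo hi ℓ.x := rfl
  rw [hw, suppIn]
  congr 1
  funext ℓ
  exact inBoxSite_eq_memSite h ℓ.x

/-- Under the licence, `psuppInB lo hi p = psuppIn p frame`. -/
theorem psuppInB_eq {frame : List (Site 2)} {lo hi : ℤ × ℤ} (h : boxLicence frame lo hi = true) (p : QPoly) :
    psuppInB lo hi p = psuppIn p frame := by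
  rw [psuppInB, psuppIn]
  congr 1
  funext t
  exact inBox_eq_suppIn h t.2

/-- The licence pins the corner: `lo = minCornerP frame`. -/
theorem lo_eq_minCornerP {frame : List (Site 2)} {lo hi : ℤ × ℤ} (h : boxLicence frame lo hi = true) :
    lo = minCornerP frame := by
  simp only [boxLicence, Bool.and_eq_true, decide_eq_true_eq] at h
  exact h.1.1.symm

/-- Under the licence, the box-anchored normal forms ARE the frame-anchored ones (corner `lo`). -/
theorem anchoredNFsB_eq {frame : List (Site 2)} {lo hi : ℤ × ℤ} (h : boxLicence frame lo hi = true) (u : Word) :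
    anchoredNFsB lo hi u = anchoredNFsV lo frame u := by
  unfold anchoredNFsB anchoredNFsV
  congr 1
  funext γ
  simp only [inBox_eq_suppIn h]

/-- Under the licence, `canonAB lo hi = canonAV lo frame`. -/
theorem canonAB_eq {frame : List (Site 2)} {lo hi : ℤ × ℤ} (h : boxLicence frame lo hi = true) (u : Word) :
    canonAB lo hi u = canonAV lo frame u := by
  unfold canonAB canonAV
  rw [anchoredNFsB_eq h]
  generalize anchoredNFsV lo frame u = L
  cases L <;> rfl

/-- **Under the licence the box canonicaliser IS the executed canonicaliser of `…SyntaxV`** at the frame's corner. -/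
theorem canonTermAB_eq {frame : List (Site 2)} {lo hi : ℤ × ℤ} (h : boxLicence frame lo hi = true) :
    canonTermAB lo hi = canonTermAV (minCornerP frame) frame := by
  funext t
  rw [canonTermAB, canonTermAV, canonAB_eq h, lo_eq_minCornerP h]

/-- The zero-filtered executed canonical pipe of `…LocalB` with the box canonicaliser. -/
def canonNFZB (lo hi : ℤ × ℤ) (p : QPoly) : QPoly :=
  (dropZeros (collect (nfPoly p))).flatMap (canonTermAB lo hi)

/-- Under the licence, `canonNFZB lo hi p = canonNFZV frame p`. -/
theorem canonNFZB_eq {frame : List (Site 2)} {lo hi : ℤ × ℤ} (h : boxLicence frame lo hi = true) (p : QPoly) :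
    canonNFZB lo hi p = canonNFZV frame p := by
  rw [canonNFZB, canonNFZV, canonTermAB_eq h]

/-! ##### (d1) Grouped R-shards with the box licence (path of record for v0′ / E-class R-literals) -/

/-- Per-call fact of grouped R-shard `j`, box form (support test and canon by box comparisons). -/
def shardOKRGB (K : SymCertR) (c : ℕ) (sizes : List ℕ) (lo hi : ℤ × ℤ) (j : ℕ) (P : QPoly) : Bool :=
  psuppInB lo hi P && isZero (psub (canonNFZB lo hi (shardPolyAtRGFast K c sizes j)) P)

/-- Under the licence the box fact IS the grouped fact of `…GramRShardsGrouped`. -/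
theorem shardOKRGB_eq (K : SymCertR) (c : ℕ) (sizes : List ℕ) {lo hi : ℤ × ℤ} (h : boxLicence K.frame lo hi = true)
    (j : ℕ) (P : QPoly) : shardOKRGB K c sizes lo hi j P = shardOKRGV K c sizes j P := by
  rw [shardOKRGB, shardOKRGV, psuppInB_eq h, canonNFZB_eq h]

/-- Per-call grouped facts, box form (structural on the literal partial list). -/
def ShardFactsRGB (K : SymCertR) (c : ℕ) (sizes : List ℕ) (lo hi : ℤ × ℤ) : ℕ → List QPoly → Prop
  | _, [] => True
  | j, P :: Ps => shardOKRGB K c sizes lo hi j P = true ∧ ShardFactsRGB K c sizes lo hi (j + 1) Ps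

/-- Box facts give grouped facts. -/
theorem shardFactsRGV_of_B (K : SymCertR) (c : ℕ) (sizes : List ℕ) {lo hi : ℤ × ℤ}
    (h : boxLicence K.frame lo hi = true) :
    ∀ (Ps : List QPoly) (j : ℕ), ShardFactsRGB K c sizes lo hi j Ps → ShardFactsRGV K c sizes j Ps
  | [], _, _ => trivial
  | P :: Ps, j, hf => ⟨(shardOKRGB_eq K c sizes h j P) ▸ hf.1, shardFactsRGV_of_B K c sizes h Ps (j + 1) hf.2⟩

/-- Eigen-check of one generated polynomial, box support test. -/
def eigenOKB (lo hi : ℤ × ℤ) (ms : List RMove) (q : QPoly) : Bool :=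
  ms.all fun m => psuppInB lo hi (movePolyF m.γ m.v q) &&
    isZero (psub (nfPoly (movePolyF m.γ m.v q)) (pscale m.χ q))

/-- Side conditions of an R-block, box support tests. -/
def gramBlockROKB (lo hi : ℤ × ℤ) (B : GramBlockR) : Bool :=
  B.reps.length == B.rows.length &&
    (B.reps.all fun s => psuppInB lo hi s && psuppInB lo hi (genPre B.moves s)) &&
    ((genBasis B).all fun q => eigenOKB lo hi B.moves q)

/-- Under the licence, `gramBlockROKB lo hi B = gramBlockROK frame B`. -/
theorem gramBlockROKB_eq {frame : List (Site 2)} {lo hi : ℤ × ℤ} (h : boxLicence frame lo hi = true) (B : GramBlockR) :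
    gramBlockROKB lo hi B = gramBlockROK frame B := by
  simp only [gramBlockROKB, gramBlockROK, eigenOKB, eigenOK, psuppInB_eq h]

/-- Side conditions of R-block `i` alone, box form (`true` past the end). -/
def gramROKAtB (K : SymCertR) (lo hi : ℤ × ℤ) (i : ℕ) : Bool :=
  match K.gramR[i]? with
  | none => true
  | some B => gramBlockROKB lo hi B

/-- Under the licence, `gramROKAtB K lo hi i = gramROKAt K i`. -/
theorem gramROKAtB_eq (K : SymCertR) {lo hi : ℤ × ℤ} (h : boxLicence K.frame lo hi = true) (i : ℕ) :
    gramROKAtB K lo hi i = gramROKAt K i := by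
  unfold gramROKAtB gramROKAt
  cases K.gramR[i]? with
  | none => rfl
  | some B => exact gramBlockROKB_eq h B

/-- The per-block box facts for `i, …, i+n−1` (structural on `n`). -/
def GramROKFactsB (K : SymCertR) (lo hi : ℤ × ℤ) : ℕ → ℕ → Prop
  | _, 0 => True
  | i, n + 1 => gramROKAtB K lo hi i = true ∧ GramROKFactsB K lo hi (i + 1) n

/-- Box per-block facts give the per-block facts of `…GramRShardsFast`. -/
theorem gramROKFacts_of_B (K : SymCertR) {lo hi : ℤ × ℤ} (h : boxLicence K.frame lo hi = true) :
    ∀ (n i : ℕ), GramROKFactsB K lo hi i n → GramROKFacts K i n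
  | 0, _, _ => trivial
  | n + 1, i, hf => ⟨(gramROKAtB_eq K h i) ▸ hf.1, gramROKFacts_of_B K h n (i + 1) hf.2⟩

/-- **All R-block side conditions from the per-block box facts.** -/
theorem gramR_all_of_factsB (K : SymCertR) (lo hi : ℤ × ℤ) (h : boxLicence K.frame lo hi = true) (n : ℕ)
    (hn : K.gramR.length = n) (hf : GramROKFactsB K lo hi 0 n) : K.gramR.all (gramBlockROK K.frame) = true :=
  gramR_all_of_facts K n hn (gramROKFacts_of_B K h n 0 hf)

/-- **SHARDED GROUPED R-REPLAY WITH THE BOX LICENCE** (closing form; grammar in the module docstring). -/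
theorem wardD4CertGe_of_shardsRGB (K : SymCertR) (hwf : wellFormed K.expand = true)
    (hRok : K.gramR.all (gramBlockROK K.frame) = true) (c : ℕ) (sizes : List ℕ) (lo hi : ℤ × ℤ)
    (hbox : boxLicence K.frame lo hi = true) (Ps : List QPoly) (hcount : shardCountRG K c sizes = Ps.length)
    (hfacts : ShardFactsRGB K c sizes lo hi 0 Ps) (hfin : isZero (canonNFZB lo hi Ps.flatten) = true) :
    WardD4CertGe ((symValueR K : ℚ) : ℝ) :=
  wardD4CertGe_of_shardsRGV K hwf hRok c sizes Ps hcount (shardFactsRGV_of_B K c sizes hbox Ps 0 hfacts)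
    (by rw [← canonNFZB_eq hbox]; exact hfin)

/-- … and the energy-density bound `symValueR K ≤ e₀(1,0,8,7/8)`. -/
theorem energyDensity_ge_of_shardsRGB (K : SymCertR) (hwf : wellFormed K.expand = true)
    (hRok : K.gramR.all (gramBlockROK K.frame) = true) (c : ℕ) (sizes : List ℕ) (lo hi : ℤ × ℤ)
    (hbox : boxLicence K.frame lo hi = true) (Ps : List QPoly) (hcount : shardCountRG K c sizes = Ps.length)
    (hfacts : ShardFactsRGB K c sizes lo hi 0 Ps) (hfin : isZero (canonNFZB lo hi Ps.flatten) = true) :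
    ((symValueR K : ℚ) : ℝ) ≤ energyDensityTT' 1 0 8 (7 / 8) :=
  energyDensity_ge_of_windowSound_cert _ WardSlot.stub_wardWindowSound
    (wardD4CertGe_of_shardsRGB K hwf hRok c sizes lo hi hbox Ps hcount hfacts hfin)

/-! ##### (d2) Local dense shards (`…LocalB`) with the box licence -/

/-- Per-call fact of local shard `j` (T16b), box form. -/
def shardOKLB (K : SymCert) (c : ℕ) (lo hi : ℤ × ℤ) (j : ℕ) (P : QPoly) : Bool :=
  psuppInB lo hi P && isZero (psub (canonNFZB lo hi (shardPolyAtLFast K c j)) P)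

/-- Under the licence the box fact IS T16b's `shardOKLV`. -/
theorem shardOKLB_eq (K : SymCert) (c : ℕ) {lo hi : ℤ × ℤ} (h : boxLicence K.frame lo hi = true) (j : ℕ) (P : QPoly) :
    shardOKLB K c lo hi j P = shardOKLV K c j P := by
  rw [shardOKLB, shardOKLV, psuppInB_eq h, canonNFZB_eq h]

/-- Per-call local facts, box form. -/
def ShardFactsLB (K : SymCert) (c : ℕ) (lo hi : ℤ × ℤ) : ℕ → List QPoly → Prop
  | _, [] => True
  | j, P :: Ps => shardOKLB K c lo hi j P = true ∧ ShardFactsLB K c lo hi (j + 1) Ps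

/-- Box local facts give T16b's local facts. -/
theorem shardFactsLV_of_B (K : SymCert) (c : ℕ) {lo hi : ℤ × ℤ} (h : boxLicence K.frame lo hi = true) :
    ∀ (Ps : List QPoly) (j : ℕ), ShardFactsLB K c lo hi j Ps → ShardFactsLV K c j Ps
  | [], _, _ => trivial
  | P :: Ps, j, hf => ⟨(shardOKLB_eq K c h j P) ▸ hf.1, shardFactsLV_of_B K c h Ps (j + 1) hf.2⟩

/-- **Sharded LOCAL replay with the box licence**, energy-density form. -/
theorem energyDensity_ge_of_shardsLB (K : SymCert) (hwf : wellFormed K = true) (c : ℕ) (lo hi : ℤ × ℤ)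
    (hbox : boxLicence K.frame lo hi = true) (Ps : List QPoly) (hcount : shardCount K c = Ps.length)
    (hfacts : ShardFactsLB K c lo hi 0 Ps) (hfin : isZero (canonNFZB lo hi Ps.flatten) = true) :
    ((symValue K : ℚ) : ℝ) ≤ energyDensityTT' 1 0 8 (7 / 8) :=
  energyDensity_ge_of_shardsLV K hwf c Ps hcount (shardFactsLV_of_B K c hbox Ps 0 hfacts)
    (by rw [← canonNFZB_eq hbox]; exact hfin)

/-! ##### (d3) One call with the box licence -/

/-- The local identity test with the box canonicaliser. -/
def identityOKLB (K : SymCert) (lo hi : ℤ × ℤ) : Bool :=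
  if K.useCanon then isZero (canonNFZB lo hi (residualL K)) else isZero (collect (nfPoly (residualL K)))

/-- **One-call box checker**: well-formedness, the licence, the local identity with the box canonicaliser. -/
def symCheckLB (K : SymCert) (lo hi : ℤ × ℤ) : Bool :=
  wellFormed K && boxLicence K.frame lo hi && identityOKLB K lo hi

/-- A passing box check is a passing local executed check (`…LocalB`). -/
theorem symCheckLV_of_symCheckLB (K : SymCert) (lo hi : ℤ × ℤ) (h : symCheckLB K lo hi = true) :
    symCheckLV K = true := by
  simp only [symCheckLB, Bool.and_eq_true] at h
  obtain ⟨⟨hwf, hbox⟩, hid⟩ := h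
  have hid' : identityOKLV K = true := by
    rw [identityOKLB, canonNFZB_eq hbox] at hid
    exact hid
  simp only [symCheckLV, hwf, hid', Bool.and_self]

/-- **One-call closing with the box licence**: `symValue K ≤ e₀(1,0,8,7/8)`. -/
theorem energyDensity_ge_symValueLB (K : SymCert) (lo hi : ℤ × ℤ) (h : symCheckLB K lo hi = true) :
    ((symValue K : ℚ) : ℝ) ≤ energyDensityTT' 1 0 8 (7 / 8) :=
  energyDensity_ge_symValueLV K (symCheckLV_of_symCheckLB K lo hi h)

/-! ##### (e) Kernel demos (`decide +kernel`, no `Lean.ofReduceBool`) -/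

/-- The toy frames are boxes: `frame3 = [−1,1]²`, `frame5 = [−2,2]²`, with the corners computed by `minCornerP/maxCornerP`. -/
example : boxLicence frame3 (minCornerP frame3) (maxCornerP frame3) = true ∧
    boxLicence frame5 ((-2 : ℤ), (-2 : ℤ)) (2, 2) = true := by decide +kernel

/-- Non-vacuity of the licence: a frame with a missing corner site is refused. -/
example : boxLicence (frame5.filter fun x => !(siteEq x (mkSite 2 2))) ((-2 : ℤ), (-2 : ℤ)) (2, 2) = false := by
  decide +kernel

/-- The `useCanon` toy closes in ONE call through the box checker … -/
example : symCheckLB toyCanonCert ((-2 : ℤ), (-2 : ℤ)) (2, 2) = true := by decide +kernel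

/-- … and `toyRCert` through the grouped R-pipe with the box licence (`sizes = []`: base + one Gram group), reusing
`…GramRShardsGrouped`'s partials `toyRGPartials`; every hypothesis by `decide +kernel`. -/
example : ((symValueR toyRCert : ℚ) : ℝ) ≤ energyDensityTT' 1 0 8 (7 / 8) :=
  energyDensity_ge_of_shardsRGB toyRCert (by decide +kernel)
    (gramR_all_of_factsB toyRCert (minCornerP frame3) (maxCornerP frame3) (by decide +kernel) 2 (by decide +kernel)
      ⟨by decide +kernel, by decide +kernel, trivial⟩)
    0 [] (minCornerP frame3) (maxCornerP frame3) (by decide +kernel) toyRGPartials (by decide +kernel)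
    ⟨by decide +kernel, by decide +kernel, trivial⟩ (by decide +kernel)

end Summit.Ventures.CertifiedManyBodySolver.Theorems.SymReplay
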